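import Summits.KontsevichZagierPeriods.KontsevichZagierPeriods.Theses.LinRedNormalForm
import Literature.NumberTheory.Transcendental.MultipleZetaValuesHoffmanProofs
import Literature.NumberTheory.Transcendental.MultipleZetaRepeatedTwosProofs
import Mathlib.LinearAlgebra.LinearIndependent.Lemmas

/-!
# Crux `HoffmanIndependence` (stmt-KontsevichZagierPeriods-15045), line `weight_split` —
# rung `n = 6` of `stub_inWeight`, typed

Companion to `Theorems/LinRedNormalFormHoffmanIndependenceRungs.lean` (which types the first open
rungs `N = 3` of `stub_weightGrading` and `n = 5` of `stub_inWeight`): the next rung of the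
in-weight stub is again ONE irrationality statement of fixed weight —
`inWeight_six_iff : (ζ(3,3), ζ(2,2,2) independent) ↔ ζ(3)² ∉ ℚ·π⁶`.
So the in-weight child of the split reads, weight by weight: `n ≤ 4` theorems
(`inWeight_of_le_four`), `n = 5` ↔ `ζ(5)/ζ(2)ζ(3) ∉ ℚ`, `n = 6` ↔ `ζ(3)²/π⁶ ∉ ℚ`, … — the
homogeneous (no cross-weight) half of the crux, whose finite rungs are the natural PSLQ /
disprover targets. Nothing here closes the item. [cite: Zagier1994, §9] [cite: Hoffman1992, Corollary 2.3]
-/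

noncomputable section

namespace Summit.KontsevichZagierPeriods.LinRedNormalForm.HoffmanIndependence

open Literature.NumberTheory.Transcendental MZV

/-- The weight-6 Hoffman indices are `(3,3)` and `(2,2,2)`: an explicit bijection with `Fin 2`.
[folklore] -/
theorem hoffmanSix_bijective :
    Function.Bijective (![⟨[3, 3], by decide, rfl⟩, ⟨[2, 2, 2], by decide, rfl⟩] :
      Fin 2 → {u : List ℕ // IsHoffman u ∧ weight u = 6}) := by
  refine ⟨fun i j hij => ?_, fun u => ?_⟩
  · fin_cases i <;> fin_cases j <;> simp_all
  · rcases u with ⟨u, hu, hw⟩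
    rcases MZV.eq_of_isHoffman_of_weight_eq_six hu hw with rfl | rfl
    · exact ⟨0, rfl⟩
    · exact ⟨1, rfl⟩

/-- **Rung `n = 6` of stub 2, typed**: the weight-6 slice of `stub_inWeight` — `ζ(3,3), ζ(2,2,2)`
`ℚ`-linearly independent — holds iff `ζ(3)² ∉ ℚ · π⁶` (it contains `ζ(3)/π³ ∉ ℚ`; open). By the
stuffle evaluation `ζ(3,3) = ζ(3)²/2 − π⁶/1890` and Hoffman's `ζ(2,2,2) = π⁶/7!` (tree theorems)
the pair is an invertible `ℚ`-linear image of `(ζ(3)², π⁶)`, and `π⁶ ≠ 0`. So the rungs of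
stub 2 are, weight by weight, single irrationality statements: `n = 5` ↔ `ζ(5)/ζ(2)ζ(3) ∉ ℚ`
(`inWeight_five_iff`), `n = 6` ↔ `ζ(3)²/π⁶ ∉ ℚ`. [cite: Zagier1994, §9] [cite: Hoffman1992, Corollary 2.3] -/
theorem inWeight_six_iff :
    LinearIndependent ℚ
        (fun u : {u : List ℕ // IsHoffman u ∧ weight u = 6} => multipleZeta u.1) ↔
      ∀ q : ℚ, multipleZeta [3] ^ 2 ≠ q * Real.pi ^ 6 := by
  rw [← linearIndependent_equiv (Equiv.ofBijective _ hoffmanSix_bijective)]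
  have hfam : (fun u : {u : List ℕ // IsHoffman u ∧ weight u = 6} => multipleZeta u.1) ∘
      (Equiv.ofBijective _ hoffmanSix_bijective) =
        ![multipleZeta [3, 3], multipleZeta [2, 2, 2]] := by
    funext i
    fin_cases i <;> rfl
  rw [hfam, LinearIndependent.pair_iff]
  have h33 : multipleZeta [3, 3] = 1 / 2 * multipleZeta [3] ^ 2 - 1 / 1890 * Real.pi ^ 6 :=
    multipleZeta_three_three_eq
  have h222 : multipleZeta [2, 2, 2] = Real.pi ^ 6 / 5040 := by
    rw [show [2, 2, 2] = List.replicate 3 2 from rfl, multipleZeta_replicate_two]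
    norm_num [Nat.factorial]
  have hpi : Real.pi ^ 6 ≠ 0 := by positivity
  constructor
  · -- a relation `ζ(3)² = q π⁶` makes `ζ(3,3)`, `ζ(2,2,2)` proportional
    intro h q hq
    have key := h 1 (-(5040 * (q / 2 - 1 / 1890))) (by
      rw [Rat.smul_def, Rat.smul_def, h33, h222, hq]
      push_cast
      ring)
    exact absurd key.1 one_ne_zero
  · -- no such relation: a vanishing combination has both coefficients zero
    intro h s t hst
    rw [Rat.smul_def, Rat.smul_def, h33, h222] at hst
    -- `hst : s (ζ(3)²/2 − π⁶/1890) + t π⁶/5040 = 0`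
    by_cases hs : s = 0
    · subst hs
      have ht : (t : ℝ) * (Real.pi ^ 6 / 5040) = 0 := by
        have := hst
        push_cast at this
        linear_combination this
      rcases mul_eq_zero.1 ht with h0 | h0
      · exact ⟨rfl, by exact_mod_cast h0⟩
      · exact absurd h0 (by positivity)
    · exfalso
      have hs' : (s : ℝ) ≠ 0 := by exact_mod_cast hs
      have key : multipleZeta [3] ^ 2 * (s : ℝ) = 2 * (s / 1890 - t / 5040) * Real.pi ^ 6 := by
        linear_combination 2 * hst
      refine h (2 * (s / 1890 - t / 5040) / s) ?_
      push_cast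
      rw [div_mul_eq_mul_div, eq_div_iff hs']
      exact key

end Summit.KontsevichZagierPeriods.LinRedNormalForm.HoffmanIndependence
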